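import Literature.NumberTheory.EllipticCurves.IsogenySeparableFactorProofs
import Literature.NumberTheory.EllipticCurves.IsogenyQuotient
import HarnessLib

/-!
# Quotient isogenies: the dual comes for free (Silverman, *AEC*, III.4.12 ⟹ III.6.1 for quotients)

D-0014 keeps `Literature/` sorry-free by stating cited results as named facts `def X : Prop`.
`Literature.NumberTheory.EllipticCurves.IsogenyQuotient` vendors, as the named fact
`WeierstrassCurve.exists_isogeny_ker_eq_and_comp_eq_nsmul W`, the package "quotient isogeny
`g : E → E' = E/S` with kernel a given finite `Γ_K`-stable subgroup `S` **and** an isogeny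
`f : E' → E` with `f ∘ g = [#S]`, `g ∘ f = [#S]`" (Silverman, *AEC*, Prop. III.4.12,
Rem. III.4.13.2, Thm. III.4.10(c), Thm. III.6.1(a), Thm. III.6.2(a)) — the geometric input of
Tate's theorem for elliptic curves over finite fields
(`Literature.AlgebraicGeometry.Motives.FaltingsECTateMainTheoremProofs`, hypothesis `hquot`).

This sibling proofs file **splits off the dual**: with *AEC* Cor. III.4.11 and Thm. II.2.3 now
proved for the prelude's isogenies (`IsogenySeparableFactorProofs`: `Isogeny.exists_eq_comp_of_ker_le` —
`ker φ ⊆ ker ψ`, `deg φ ≤ #ker φ` ⟹ `ψ = λ ∘ φ` — and `Isogeny.surjective`), the isogeny `f` with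
`f ∘ g = [#S]`, `g ∘ f = [#S]` is obtained from the separable quotient `g` alone
(`Isogeny.exists_dual_of_deg_le_card_ker`: `[#S]` kills `S = ker g` (Lagrange), so `[#S] = f ∘ g`
by III.4.11, and then `g ∘ f = [#S]` on `E' = g(E)`) — exactly as Silverman constructs the dual
isogeny in the proof of Thm. III.6.1(a) ("since `#ker φ = m` … by III.4.11 there is `φ̂` with
`φ̂ ∘ φ = [m]`"). Hence the named fact of `IsogenyQuotient` follows from the smaller named fact
vendored here,

* `WeierstrassCurve.exists_separable_isogeny_ker_eq W` — Silverman, *AEC*, Prop. III.4.12 with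
  Rem. III.4.13.2 (existence over `K` of the separable quotient `g : E → E/S` with `ker g = S`),
  together with the printed property of `g` that the deduction uses, `deg g = #S`
  (Thm. III.4.10(c) with (a): a separable isogeny has `#ker = deg`) —

by `WeierstrassCurve.exists_isogeny_ker_eq_and_comp_eq_nsmul_of_separable_quotient`. What remains
unproved of `hquot` is thus precisely the construction of the quotient curve `E/S` and of the
separable isogeny with kernel `S` onto it (Vélu's formulae), not the dual isogeny.

## References

* [SilvermanAEC2009] J. H. Silverman, *The Arithmetic of Elliptic Curves*, 2nd ed., GTM 106,
  Springer 2009: Thm. II.2.3, Thm. III.4.10, Cor. III.4.11, Prop. III.4.12, Rem. III.4.13.2,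
  Thm. III.6.1(a) and its proof, Thm. III.6.2(a).
* J. Vélu, *Isogénies entre courbes elliptiques*, C. R. Acad. Sci. Paris Sér. A **273** (1971),
  238–241 (explicit equations for `E/S` and `g`; the route by which
  `exists_separable_isogeny_ker_eq` would be discharged for Weierstrass curves).

## Design

`noncomputable section`, `open scoped Classical`, `K : Type u`, dot-notation extensions in
`namespace WeierstrassCurve`, the standing hypothesis `[PerfectField K]` of *AEC* quantified in
the body of the named fact exactly as in `IsogenyQuotient`.
-/

noncomputable section

open scoped Classical

universe u

namespace WeierstrassCurve

variable {K : Type u} [Field K] (W : WeierstrassCurve K)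

/-- **The separable quotient isogeny** (named fact). Let `K` be a perfect field, `E` an elliptic
curve over `K` and `S ⊆ E(K̄)` a finite subgroup stable under `Γ_K = Gal(K̄/K)`. Then there are an
elliptic curve `E'` over `K` and an isogeny `g : E → E'` defined over `K` with `ker g = S` (on
`K̄`-points) and of degree `deg g = [K̄(E) : g^* K̄(E')] = #S`. This is Silverman, *AEC*,
Prop. III.4.12 ("there are a unique elliptic curve `E'` and a separable isogeny `φ : E → E'`
satisfying `ker φ = Φ`"), defined over `K` by Rem. III.4.13.2 (`Φ` is `G_{K̄/K}`-invariant), with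
`deg φ = #ker φ` for separable `φ` (Thm. III.4.10(c) with (a)).
[cite: SilvermanAEC2009, Prop. III.4.12 with Rem. III.4.13.2 and Thm. III.4.10(a),(c)] -/
def exists_separable_isogeny_ker_eq : Prop :=
  ∀ [PerfectField K] [W.IsElliptic] (S : AddSubgroup W.geomPoints), (S : Set W.geomPoints).Finite →
    (∀ (σ : Field.absoluteGaloisGroup K) (P : W.geomPoints), P ∈ S → σ • P ∈ S) →
    ∃ (W' : WeierstrassCurve K) (_ : W'.IsElliptic) (g : Isogeny W W'),
      g.toAddMonoidHom.ker = S ∧ g.deg = Nat.card S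

variable {W}

/-- Unfolding lemma for `exists_separable_isogeny_ker_eq` (`Iff.rfl`). [folklore] -/
theorem exists_separable_isogeny_ker_eq_iff :
    W.exists_separable_isogeny_ker_eq ↔
      ∀ [PerfectField K] [W.IsElliptic] (S : AddSubgroup W.geomPoints),
        (S : Set W.geomPoints).Finite →
        (∀ (σ : Field.absoluteGaloisGroup K) (P : W.geomPoints), P ∈ S → σ • P ∈ S) →
        ∃ (W' : WeierstrassCurve K) (_ : W'.IsElliptic) (g : Isogeny W W'),
          g.toAddMonoidHom.ker = S ∧ g.deg = Nat.card S :=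
  Iff.rfl

/-- **`hquot` from the separable quotient alone**: the named fact
`exists_isogeny_ker_eq_and_comp_eq_nsmul W` of `IsogenyQuotient` (quotient isogeny `g` with
kernel `S` and an isogeny `f` with `f ∘ g = [#S]`, `g ∘ f = [#S]`) follows from the named fact
`exists_separable_isogeny_ker_eq W` (the separable quotient `g`, *AEC* Prop. III.4.12 with
Rem. III.4.13.2, Thm. III.4.10(c)), the isogeny `f` being supplied by
`Isogeny.exists_dual_of_deg_le_card_ker` of `IsogenySeparableFactorProofs` (Cor. III.4.11 and Thm. II.2.3,
proved). [cite: SilvermanAEC2009, Prop. III.4.12 with Thm. III.6.1(a)] -/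
theorem exists_isogeny_ker_eq_and_comp_eq_nsmul_of_separable_quotient
    (h : W.exists_separable_isogeny_ker_eq) : W.exists_isogeny_ker_eq_and_comp_eq_nsmul := by
  intro _ _ S hS hstab
  obtain ⟨W', hW', g, hker, hdeg⟩ := h S hS hstab
  have hcard : Nat.card g.toAddMonoidHom.ker = Nat.card S := by rw [hker]
  obtain ⟨f, hfg, hgf⟩ := g.exists_dual_of_deg_le_card_ker (by rw [hdeg, hcard])
  refine ⟨W', hW', g, f, hker, fun P ↦ ?_, fun Q ↦ ?_⟩
  · rw [hfg P, hcard]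
  · rw [hgf Q, hcard]

end WeierstrassCurve
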